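import Summits.ResolutionOfSingularities.ResolutionOfSingularities.Theorems.FrobeniusClosingSteerDescentSpace
import Mathlib.Algebra.CharP.Lemmas
import Mathlib.FieldTheory.Perfect
import HarnessLib

/-!
# Descent space, file 2 (W4.1, F-B card 7): squares in characteristic `2` and TRUNCATED SQUARES (L1-core)

W4.1, crux `Steer` (stmt-ResolutionOfSingularities-16345), frontier piece F-B; polynomial cores of res-L0-w41-idea-1's card 7
`kangaroo-free-parity-automaton` (`Sketch-idea-1-v9-fb.lean` 1cd28c90a6f7445c; res-L0-w41-plan-1 RULINGS 81b/84d; idea-1 g8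
«citable: yes»). Over the definitions of `FrobeniusClosingSteerDescentSpace.lean` (seat res-D-pv-007 AS res-L0-w41-stub-5):
in characteristic `2`, `Q² = Σ (coeff_m Q)² X^(2m)` (`sq_eq_sum_monomial`), monomials of a square are doubled
(`exists_eq_two_nsmul_of_mem_support_sq`, `even_of_mem_support_sq`, `exists_degree_eq_of_mem_support_sq`), a polynomial with
only even exponents over a PERFECT field is a square (`exists_sq_eq_of_forall_even`, `isSquare_of_forall_even`), and
**L1-core `isSquare_of_subTopIsSquare_succ`** (the sketch's `stub_isSquare_of_subTopIsSquare_succ`, PROVED — the polynomial heart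
of the half-order ratchet, even case): total degree `≤ n` and a square modulo monomials of degree `≥ n + 1` ⇒ a square.

OURS (research support for an idea card; candidates, not facts); nothing here is a statement of the manuscript under review
[claim: Hironaka2017, status: under-review]; AI work, weaker than expert review. [cite: Hauser2010, §F (Moh's bound)] [folklore]
-/

noncomputable section

-- `Summit.<S>.<S>.…` duplicates the summit name by design (single-problem summit).
set_option linter.dupNamespace false

open MvPolynomial

namespace Summit.ResolutionOfSingularities.ResolutionOfSingularities.Theorems.SwitchingDichotomy.DescentSpace

universe u v

/-! ## §3 Squares in characteristic `2`: doubled supports, square roots over a perfect field, truncated squares -/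

section Squares

variable {κ : Type u} [Field κ] {σ : Type v}

/-- In characteristic `2`, `Q² = Σ_m (coeff_m Q)² · X^(2m)`. [folklore] -/
theorem sq_eq_sum_monomial [CharP κ 2] (Q : MvPolynomial σ κ) :
    Q ^ 2 = ∑ m ∈ Q.support, monomial (2 • m) (coeff m Q ^ 2) := by
  conv_lhs => rw [Q.as_sum]
  rw [sum_pow_char 2]
  refine Finset.sum_congr rfl fun m _ => ?_
  rw [monomial_pow]

/-- In characteristic `2`, the coefficient of `X^m` in `Q²` is `(coeff_{m/2} Q)²` if every exponent of `m` is even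
(and `0` otherwise): here the membership form — a monomial of `Q²` is a doubled exponent vector. [folklore] -/
theorem exists_eq_two_nsmul_of_mem_support_sq [CharP κ 2] (Q : MvPolynomial σ κ) {m : σ →₀ ℕ}
    (hm : m ∈ (Q ^ 2).support) : ∃ m' : σ →₀ ℕ, m = 2 • m' := by
  classical
  rw [sq_eq_sum_monomial, mem_support_iff, coeff_sum] at hm
  by_contra hne
  apply hm
  refine Finset.sum_eq_zero fun m' _ => ?_
  rw [coeff_monomial, if_neg]
  exact fun h => hne ⟨m', h.symm⟩

/-- Every exponent of a monomial of `Q²` is even (characteristic `2`). [folklore] -/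
theorem even_of_mem_support_sq [CharP κ 2] (Q : MvPolynomial σ κ) {m : σ →₀ ℕ}
    (hm : m ∈ (Q ^ 2).support) (j : σ) : Even (m j) := by
  obtain ⟨m', rfl⟩ := exists_eq_two_nsmul_of_mem_support_sq Q hm
  exact ⟨m' j, by simp [two_nsmul]⟩

/-- The degree of a monomial of `Q²` is twice the degree of a monomial of `Q` (characteristic `2`): every monomial
of `Q²` has degree `2·(degree of some monomial of Q)`. [folklore] -/
theorem exists_degree_eq_of_mem_support_sq [CharP κ 2] (Q : MvPolynomial σ κ) {m : σ →₀ ℕ}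
    (hm : m ∈ (Q ^ 2).support) :
    ∃ m' ∈ Q.support, m = 2 • m' := by
  classical
  rw [sq_eq_sum_monomial, mem_support_iff, coeff_sum] at hm
  by_contra hne
  push Not at hne
  apply hm
  refine Finset.sum_eq_zero fun m' hm' => ?_
  rw [coeff_monomial, if_neg]
  exact fun h => hne m' hm' h.symm

/-- **Over a perfect field of characteristic `2`, a polynomial all of whose exponents are even is a square**:
`Σ a_m X^m = (Σ √a_m X^(m/2))²`. [folklore] -/
theorem exists_sq_eq_of_forall_even [CharP κ 2] [PerfectField κ] (Φ : MvPolynomial σ κ)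
    (h : ∀ m ∈ Φ.support, ∀ j, Even (m j)) : ∃ Q : MvPolynomial σ κ, Q ^ 2 = Φ := by
  classical
  -- halve the exponents and take square roots of the coefficients
  have hhalf : ∀ m ∈ Φ.support, 2 • (Finsupp.mapRange (fun n => n / 2) (by simp) m) = m := by
    intro m hm
    ext j
    obtain ⟨r, hr⟩ := h m hm j
    simp only [Finsupp.smul_apply, Finsupp.mapRange_apply, smul_eq_mul]
    omega
  refine ⟨∑ m ∈ Φ.support, monomial (Finsupp.mapRange (fun n => n / 2) (by simp) m)
      ((frobeniusEquiv κ 2).symm (coeff m Φ)), ?_⟩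
  rw [sum_pow_char 2]
  conv_rhs => rw [Φ.as_sum]
  refine Finset.sum_congr rfl fun m hm => ?_
  rw [monomial_pow, hhalf m hm]
  congr 1
  rw [← frobenius_def, ← frobeniusEquiv_apply, RingEquiv.apply_symm_apply]

/-- A polynomial with a square root is `IsSquare`. [folklore] -/
theorem isSquare_of_forall_even [CharP κ 2] [PerfectField κ] (Φ : MvPolynomial σ κ)
    (h : ∀ m ∈ Φ.support, ∀ j, Even (m j)) : IsSquare Φ := by
  obtain ⟨Q, hQ⟩ := exists_sq_eq_of_forall_even Φ h
  exact ⟨Q, by rw [← hQ, sq]⟩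

/-- **L1-core — TRUNCATED SQUARES** (res-L0-w41-idea-1 card 7 `stub_isSquare_of_subTopIsSquare_succ`, PROVED; the
polynomial heart of the half-order ratchet, even case): in characteristic `2`, a polynomial of total degree `≤ n` which
is a square modulo monomials of degree `≥ n + 1` IS a square. (Truncate `q` at degree `n/2`: `q = q_≤ + q_>`,
`q² = q_≤² + q_>²`, every monomial of `q_>²` has degree `≥ n + 1`, and `P − q_≤²` has degree `≤ n`.) [folklore] -/
theorem isSquare_of_subTopIsSquare_succ [CharP κ 2] (n : ℕ) (P : MvPolynomial σ κ)
    (hP : P.totalDegree ≤ n) (h : SubTopIsSquare κ (n + 1) P) : IsSquare P := by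
  classical
  obtain ⟨q, hq⟩ := h
  -- split `q` at degree `n / 2`
  set lo : MvPolynomial σ κ :=
    ∑ m ∈ q.support.filter (fun m => 2 * (m.sum fun _ e => e) ≤ n), monomial m (coeff m q) with hlo
  set hi : MvPolynomial σ κ :=
    ∑ m ∈ q.support.filter (fun m => ¬ 2 * (m.sum fun _ e => e) ≤ n), monomial m (coeff m q) with hhi
  have hsplit : q = lo + hi := by
    rw [hlo, hhi, Finset.sum_filter_add_sum_filter_not]
    exact q.as_sum
  have hsq : q ^ 2 = lo ^ 2 + hi ^ 2 := by rw [hsplit, add_pow_char]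
  -- every monomial of `hi ^ 2` has degree `≥ n + 1`
  have hcoeff_hi : ∀ m, coeff m hi = if ¬ 2 * (m.sum fun _ e => e) ≤ n then coeff m q else 0 := by
    intro m
    rw [hhi, coeff_sum]
    simp only [coeff_monomial]
    rw [Finset.sum_ite_eq']
    simp only [Finset.mem_filter, mem_support_iff, ne_eq]
    by_cases h0 : coeff m q = 0 <;> simp [h0]
  have hhi_deg : ∀ m ∈ (hi ^ 2).support, n + 1 ≤ m.sum fun _ e => e := by
    intro m hm
    obtain ⟨m', hm', rfl⟩ := exists_degree_eq_of_mem_support_sq hi hm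
    have hm'q : ¬ 2 * (m'.sum fun _ e => e) ≤ n := by
      rw [mem_support_iff, hcoeff_hi] at hm'
      by_contra hle
      exact hm' (by rw [if_neg (not_not.mpr hle)])
    have : (2 • m').sum (fun _ e => e) = 2 * m'.sum (fun _ e => e) := by
      rw [Finsupp.sum_smul_index' (fun _ => rfl)]  -- may need adjusting
      simp [Finsupp.sum, Finset.mul_sum, smul_eq_mul]
    omega
  -- every monomial of `lo` has degree `≤ n / 2`, so `lo ^ 2` has degree `≤ n`
  have hlo_deg : (lo ^ 2).totalDegree ≤ n := by
    refine (totalDegree_pow lo 2).trans ?_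
    have : lo.totalDegree ≤ n / 2 := by
      rw [hlo]
      refine (totalDegree_finsetSum _ _).trans (Finset.sup_le fun m hm => ?_)
      rw [Finset.mem_filter] at hm
      refine (totalDegree_monomial_le _ _).trans ?_
      have h2 : (m.sum fun _ => id) = m.sum fun _ e => e := rfl
      omega
    omega
  -- hence `P - lo ^ 2 = 0`
  have hzero : P - lo ^ 2 = 0 := by
    by_contra hne
    obtain ⟨m, hm'⟩ := exists_coeff_ne_zero hne
    have hm : m ∈ (P - lo ^ 2).support := mem_support_iff.mpr hm'
    -- degree `≤ n` ...
    have hle : (m.sum fun _ e => e) ≤ n := by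
      refine (le_totalDegree hm).trans ?_
      refine (totalDegree_sub _ _).trans (max_le hP hlo_deg)
    -- ... and `≥ n + 1`, since `P - lo² = (P - q²) + hi²`
    have heq : P - lo ^ 2 = (P - q ^ 2) + hi ^ 2 := by rw [hsq]; ring
    rw [heq] at hm
    have hge : n + 1 ≤ m.sum fun _ e => e := by
      rcases Finset.mem_union.mp (support_add hm) with h1 | h2
      · exact hq m h1
      · exact hhi_deg m h2
    omega
  exact ⟨lo, by rw [← sq]; exact (sub_eq_zero.mp hzero)⟩

end Squares

end Summit.ResolutionOfSingularities.ResolutionOfSingularities.Theorems.SwitchingDichotomy.DescentSpace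

end
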